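import Summits.QuantumFields.YangMills.Theorems.BalabanUVNodesN22W1PrintedBoxWitnessLargeField
import Summits.QuantumFields.YangMills.Theorems.BalabanUVNodesN22W1PrintedBoxWitnessSmallField
import Summits.QuantumFields.YangMills.Theorems.BalabanUVNodesN22W1PrintedBoxBlockAtDatum

/-!
# BalabanUVNodes ∕ node N22 = NE9 — A6 FOR THE PRINTED BOX BLOCK, WINDOW-UNIFORM: ONE vertex constant `Mv` for EVERY base point `s₀ ∈ ]0, γ]` — `SliceInputsL2U` is inhabited with
# print's boxes at every label with `|P(t)| ≤ 1`, uniformly on the coupling window, as soon as `20·a⁺ ≤ (ε₁∕γ)²` (the knit J17-K fixes `a`, `Mv` across `∀ s₀ ∈ Ioc 0 θ.γ`)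

Cell `pub-ymgap`, HUMAN RULING D-0062 (Track A) ∕ D-0149 (width seats), seat `pub-ymgap-dag-n22-w1` (WIDTH SEAT 1 of 3 on node n22; «A6-residue flag №3 lane»), generation 0, file 6.
THEOREMS ONLY (0 `def`, 0 `sorry`); imports this seat's files 4 ∕ 5 (`sliceInputsL2U_inhabited_largeField_printedBoxes`, `sliceInputsL2U_inhabited_smallField_printedBoxes`) and 2
(`threshold_sq_window_le`; file 1's `exp_neg_div_sq_le` through it); restates nothing.  `--kind proof --supports stmt-QuantumFields-20544 --as helper` (K3⁷ `SpineGivenEndpointR13SepCoPH`).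

WHY.  dag-n22-c's knit J17-K asks its located-input record at EVERY `s₀ ∈ Ioc 0 θ.γ` with the letters `a`, `Mv` FIXED; files 4 ∕ 5 inhabit the record with print's boxes per base point
under s₀-dependent window relations.  THIS FILE discharges those relations UNIFORMLY on a window `]0, γ]`: with `Mv(γ-free) := 1 + (e·ε₁²∕40)⁻¹·(1 + e^{a⁺∕2})` (file 1's `e^{−c∕s²} ≤ s²∕(e·c)`)
and the ONE window numeral `20·a⁺ ≤ (ε₁∕γ)²`, every base point `s₀ ≤ γ` and every label with `|P(t)| ≤ 1` gets an inhabitant — the A6 statement in the knit's own quantifier shape.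
Labels with `|P(t)| ≥ 2` are NOT covered: at the free ONE-row-bond kernel datum print's large-field function needs `|Λ| ≥ |P|` row bonds (node00-def-B13's `|Pl| = |P|`); a print-box
witness there requires multi-bond kernel data with NODE A's smallness — said, not claimed.

HONEST FRAMING — what this is NOT.  Inhabitation at DEGENERATE kernel data with print's box shapes; nothing of Bałaban's asserted; no joint witness with the knit's tables ∕ numerals ∕ `hlaw` ∕
N18-below; count-neutral; N22 NOT discharged (typed 28∕28 · discharged 5∕27 UNCHANGED); one finite four-torus programme at fixed ε — R4 closes the conditional rung `BalabanLadder.UV` only;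
NOT continuum, NOT OS, NOT a mass gap, NOT Clay.  0 `sorry`, standard axioms.

References (TYPES only): [II] = [Balaban1988RG2Cluster] (2.3) p. 12, (2.22) p. 16; [I] = [Balaban1987RG1] §1 p. 263, (2.9)–(2.13) pp. 266–268.
-/

noncomputable section

namespace Summit.QuantumFields.YangMills.BalabanUVNodes.N22PrintedBoxBlock

open Set Metric Matrix
open scoped BigOperators
open Literature.MathematicalPhysics.QuantumFieldTheory.Balaban1983to89
open Literature.MathematicalPhysics.QuantumFieldTheory.Balaban1983to89.TreeLengthTorus (TPt TDom)
open Literature.MathematicalPhysics.QuantumFieldTheory.Balaban1983to89.Step (SFConsts)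
open Literature.MathematicalPhysics.QuantumFieldTheory.Balaban1983to89.Node00
open Literature.MathematicalPhysics.QuantumFieldTheory.Balaban1983to89.Node00.Sect2 (domSys domCount CPair Setting Residual)
open Literature.MathematicalPhysics.QuantumFieldTheory.Balaban1983to89.Node00.W1
open YMDAG.N22.W1 (SliceInputsL2U)

/-! ## §1 The two window relations, discharged uniformly on `]0, γ]` -/

/-- **SMALL-FIELD RELATION, UNIFORM**: for `ε > 0` and ANY `Mv` with `(e·(ε²∕40))⁻¹ ≤ Mv − 1`, every `s₀ > 0` has `e^{−(ε∕s₀)²∕40} ≤ (Mv − 1)·s₀²` (file 1 `exp_neg_div_sq_le`).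
[cite: Balaban1987RG1, (2.13) p.268] -/
theorem smallField_relation_uniform {ε s₀ Mv : ℝ} (hε : 0 < ε) (hs : 0 < s₀) (hMv : (Real.exp 1 * (ε ^ 2 / 40))⁻¹ ≤ Mv - 1) :
    Real.exp (-((ε / s₀) ^ 2 / 40)) ≤ (Mv - 1) * s₀ ^ 2 := by
  have h := exp_neg_div_sq_le (c := ε ^ 2 / 40) (by positivity) hs.ne'
  have hre : (ε / s₀) ^ 2 / 40 = ε ^ 2 / 40 / s₀ ^ 2 := by rw [div_pow]; ring
  rw [hre]
  exact h.trans (mul_le_mul_of_nonneg_right hMv (sq_nonneg _))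

/-- **LARGE-FIELD RELATION, UNIFORM**: for `ε > 0` and ANY `Mv` with `e^{a⁺∕2}·(e·(ε²∕40))⁻¹ ≤ Mv`, every `s₀ > 0` has `e^{−((ε∕s₀)² − 20a⁺)∕40} ≤ Mv·s₀²`.
[cite: Balaban1988RG2Cluster, (2.22) p.16; Balaban1987RG1, (2.13) p.268] -/
theorem largeField_relation_uniform {ε s₀ Mv : ℝ} (a : ℝ) (hε : 0 < ε) (hs : 0 < s₀)
    (hMv : Real.exp (20 * max a 0 / 40) * (Real.exp 1 * (ε ^ 2 / 40))⁻¹ ≤ Mv) :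
    Real.exp (-(((ε / s₀) ^ 2 - 20 * max a 0) / 40)) ≤ Mv * s₀ ^ 2 := by
  have h := exp_neg_div_sq_le (c := ε ^ 2 / 40) (by positivity) hs.ne'
  have hsplit : Real.exp (-(((ε / s₀) ^ 2 - 20 * max a 0) / 40)) = Real.exp (20 * max a 0 / 40) * Real.exp (-(ε ^ 2 / 40 / s₀ ^ 2)) := by
    rw [← Real.exp_add]
    congr 1
    rw [div_pow]
    ring
  rw [hsplit]
  calc Real.exp (20 * max a 0 / 40) * Real.exp (-(ε ^ 2 / 40 / s₀ ^ 2))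
      ≤ Real.exp (20 * max a 0 / 40) * ((Real.exp 1 * (ε ^ 2 / 40))⁻¹ * s₀ ^ 2) := mul_le_mul_of_nonneg_left h (Real.exp_pos _).le
    _ = Real.exp (20 * max a 0 / 40) * (Real.exp 1 * (ε ^ 2 / 40))⁻¹ * s₀ ^ 2 := by ring
    _ ≤ Mv * s₀ ^ 2 := mul_le_mul_of_nonneg_right hMv (sq_nonneg _)

/-- On the window `s₀ ≤ γ` the numeral `20·a⁺ ≤ (ε∕γ)²` gives `20·a⁺ ≤ (ε∕s₀)²` (file 2 `threshold_sq_window_le`). [cite: Balaban1988RG2Cluster, (2.22) p.16] -/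
theorem gain_relation_window {a ε γ s₀ : ℝ} (hε : 0 ≤ ε) (hs : 0 < s₀) (hsγ : s₀ ≤ γ) (ha : 20 * max a 0 ≤ (ε / γ) ^ 2) :
    20 * max a 0 ≤ (ε / s₀) ^ 2 :=
  ha.trans (threshold_sq_window_le hε hs hsγ)

/-! ## §2 ONE `Mv` for the whole window: `SliceInputsL2U` inhabited with print's boxes at every `s₀ ∈ ]0, γ]` and every label with `|P(t)| ≤ 1` -/

section Window

variable (c : B13.Consts) (P : Params) (𝔸 : Type*) [NormedRing 𝔸] [NormedAlgebra ℂ 𝔸] [CompleteSpace 𝔸] (M k L : ℕ) [NeZero L]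

open Classical in
/-- ★ **THE WINDOW-UNIFORM PRINT-BOX INHABITANT IN THE KNIT's QUANTIFIER SHAPE**: for every window radius `γ` with the ONE numeral `20·a⁺ ≤ (ε₁∕γ)²` and every vertex constant
`Mv ≥ 1 + (e·ε₁²∕40)⁻¹·(1 + e^{a⁺∕2})`, EVERY base point `s₀ ∈ Ioc 0 γ`, every nonempty domain `Z` and every label with `|P(t)| ≤ 1` admit a datum, print's boxes on row-bond sets
`(Y₀, Pl)` of the term and an inhabitant of `SliceInputsL2U … univ s₀ a 2 (1∕12) Mv` (small-field labels by file 5, `|P(t)| = 1` by file 4).  Degenerate kernel data; nothing of Bałaban's.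
[cite: Balaban1987RG1, (2.9) p.266 and §1 p.263; Balaban1988RG2Cluster, (2.3) p.12 and (2.22) p.16 (degenerate data; bookkeeping)] -/
theorem sliceInputsL2U_inhabited_printedBoxes_window (hκ₁ : 1 ≤ c.κ₁) (hE : 0 < c.E₀) (hε : 0 < c.ε₁) (hC₁ : 0 < c.C₁) (hα : 0 < c.α₄) (hMc : 0 < c.M)
    (hδκ : 0 ≤ (1 - 3 * c.δ) * c.κ) (hpref : c.E₀ * c.ε₁ * c.C₁ * c.α₄⁻¹ * c.M ^ c.q * Real.exp (c.C₂ * c.κ₁) ≤ 1 / 2)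
    {G : Type*} [GaugeGroup G] (Sg : Setting 𝔸 G) (Rz : Residual P 𝔸) (cs : SFConsts) {E₀ : ℝ} (hE₀ : 0 ≤ E₀) (κE : ℝ)
    {a γ Mv : ℝ} (ha : 20 * max a 0 ≤ (c.ε₁ / γ) ^ 2)
    (hMv : 1 + (Real.exp 1 * (c.ε₁ ^ 2 / 40))⁻¹ * (1 + Real.exp (20 * max a 0 / 40)) ≤ Mv)
    {s₀ : ℝ} (hs₀ : s₀ ∈ Ioc (0 : ℝ) γ) (Z : (domSys P M (k + 1)).Dom) (hZ : 1 ≤ (Z.1).card) (t : TermLabel P M k L) (ht : t.2.card ≤ 1) :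
    ∃ (𝔇 : TermDatum214 c P 𝔸 M k L)
      (χu χcu : (Z : (domSys P M (k + 1)).Dom) → (t : TermLabel P M k L) → ((𝔇.𝒦 Z t).Λ → ℝ) → ℝ)
      (𝒲 : (Z : (domSys P M (k + 1)).Dom) → (t : TermLabel P M k L) → CPair P 𝔸 → TDom P.d (L * domCount P M (k + 1)) → ((𝔇.𝒦 Z t).Λ → ℝ) → ℂ)
      (𝒪 : (Z : (domSys P M (k + 1)).Dom) → (t : TermLabel P M k L) → OlderTerms P 𝔸 M k → CPair P 𝔸 → TDom P.d (L * domCount P M (k + 1)) →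
        ((𝔇.𝒦 Z t).Λ → ℝ) → ℂ)
      (Y₀ Pl : Finset (𝔇.𝒦 Z t).Λ),
      (∀ A, χu Z t A = ∏ b ∈ Y₀, (if |A b| < c.ε₁ then (1 : ℝ) else 0)) ∧
      (∀ A, χcu Z t A = ∏ b ∈ Pl, (if c.ε₁ ≤ |A b| then (1 : ℝ) else 0)) ∧
      Pl.card = t.2.card ∧
      Nonempty (SliceInputsL2U 𝔇 χu χcu 𝒲 𝒪 c Sg Rz cs E₀ κE Z t Set.univ s₀ a 2 (1 / 12) Mv) := by
  have hpos : 0 < (Real.exp 1 * (c.ε₁ ^ 2 / 40))⁻¹ := by positivity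
  by_cases hP : t.2 = ∅
  · -- small-field label: file 5 at the uniform relation
    have hrel : Real.exp (-((c.ε₁ / s₀) ^ 2 / 40)) ≤ (Mv - 1) * s₀ ^ 2 :=
      smallField_relation_uniform hε hs₀.1 (by nlinarith [Real.exp_pos (20 * max a 0 / 40)])
    obtain ⟨𝔇, χu, χcu, 𝒲, 𝒪, hχu, hχcu, hcard, hne⟩ :=
      sliceInputsL2U_inhabited_smallField_printedBoxes c P 𝔸 M k L hκ₁ hE hε hC₁ hα hMc hδκ hpref Sg Rz cs hE₀ κE Z hZ t hP hs₀.1 hrel a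
    refine ⟨𝔇, χu, χcu, 𝒲, 𝒪, Finset.univ, ∅, hχu Z t, hχcu Z t, ?_, hne⟩
    rw [Finset.card_empty, hP, Finset.card_empty]
  · -- `|P(t)| = 1`: file 4 at the uniform relations
    have hP1 : t.2.card = 1 := le_antisymm ht (Finset.card_pos.2 (Finset.nonempty_iff_ne_empty.2 hP))
    have hrel : Real.exp (-(((c.ε₁ / s₀) ^ 2 - 20 * max a 0) / 40)) ≤ Mv * s₀ ^ 2 :=
      largeField_relation_uniform a hε hs₀.1 (by nlinarith [Real.exp_pos (20 * max a 0 / 40)])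
    obtain ⟨𝔇, χu, χcu, 𝒲, 𝒪, hχu, hχcu, hcard, hne⟩ :=
      sliceInputsL2U_inhabited_largeField_printedBoxes c P 𝔸 M k L hκ₁ hE hε hC₁ hα hMc hδκ hpref Sg Rz cs hE₀ κE Z hZ t hP1 hs₀.1 a
        (gain_relation_window hε.le hs₀.1 hs₀.2 ha) hrel
    refine ⟨𝔇, χu, χcu, 𝒲, 𝒪, ∅, Finset.univ, hχu Z t, hχcu Z t, ?_, hne⟩
    rw [hcard Z t, hP1]

end Window

end Summit.QuantumFields.YangMills.BalabanUVNodes.N22PrintedBoxBlock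

end
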